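import Mathlib
import HarnessLib
import Summits.HubbardSuperconductivity.HubbardSuperconductivity.Theorems.KLProgrammeKLRegimeTwoVolumeReadoutScaleZero
import Summits.HubbardSuperconductivity.HubbardSuperconductivity.Theorems.KLProgrammeKLRegimeTwoVolumeGridBlockStepResponse

/-!
# The scale-`0` nested spatial leg of (E3f-F) from ONE-VOLUME GRID DATA (β′ two-volume pass, composition; cell gate-hubbard-kl, seat k3c5-p2 g6)

Composition of the read-out door `abs_klLocalPart_flowFrame_zero_sub_le` (engine currency, grid `N = 2(2M)`, pin `w₀ = (0,(r₀,r₀))`,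
`r₀ = (L₁−1)/2`) with the response-form model step `hubbardGrid_sum_norm_kernel_sub_le_response` at `n = 1`, `p = 0`, `ν = 0`, pin
`((w₀,↑),+)`, zone depths `R + R′ ≤ r₀`, bare symbol `uvSymbolCT … 0 klE0 = (βL²)·u(p_k)` (`uvSymbolCT_eq_mul_sampled`).  The result bounds
`|klLocalPart L₁ M β U μ (K₀ L₁) 0 θ − klLocalPart L₂ M β U μ (K₀ L₂) 0 θ|`, `L₂ = b·L₁`, by `(2N/|β|)·B + 2·(2N/|β|)·Nw₁/((L₁−1)/2+1)` with `B` the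
model step's explicit bound, in terms of ONE-VOLUME data of the two grid covariances `G_L = S_Lᵀ C⁰_L S_L` (`L = L₁, L₂`): all-times far row tail
`T`, fixed-time far spatial sums `Te`, sup entries `s, s′`, row sums `α, α′`, first moments `m₁, m₁′` (reduced distance for the fine one), Gram
properties `κ, κ′`, the coarse `(1+diam)`-weighted profile `Nw`, the fine degree-`2` profile `Nw₁`, grid partition functions, and the two
smallness conditions `θw, θ₂ < 1`.  Sorry-free; no definition.
-/

noncomputable section

namespace Summit.HubbardSuperconductivity.HubbardSuperconductivity.Theorems.TwoVolumeDefect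

open Finset Literature.MathematicalPhysics.QuantumLattice GrassmannAlgebra Literature.Probability.LatticeModels
  Literature.Probability.LatticeModels.BattleFederbush
open Summit.HubbardSuperconductivity.HubbardSuperconductivity.Theorems.KLProgrammeLegKernels
open Summit.HubbardSuperconductivity.HubbardSuperconductivity.Theorems.KLRegimeSplit
open Summit.HubbardSuperconductivity.HubbardSuperconductivity.Theorems.EngineV8
open scoped Nat

/-- **THE SCALE-`0` NESTED SPATIAL LEG FROM ONE-VOLUME GRID DATA.**  See the module docstring; `G₁`, `G₂` are the two grid covariances
`S_Lᵀ C⁰_L S_L` at `L = L₁, L₂ = b·L₁` on the grid `N = 2(2M)`, the interactions are the bare grid interactions. -/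
theorem abs_klLocalPart_flowFrame_zero_sub_le_of_gridData {L₁ L₂ b M : ℕ} [NeZero L₁] [NeZero L₂] [NeZero M]
    (hL : L₂ = b * L₁) {β : ℝ} (hβ : 0 < β) (U μ : ℝ) (R R' : ℕ) (hRR : R + R' ≤ (L₁ - 1) / 2)
    -- decay numbers of the two grid covariances
    {T : ℝ} (hT0 : 0 < T)
    (hT : ∀ X', ∑ Y' ∈ univ.filter (fun Y' : GridLeg (GridPoint L₂ (2 * (2 * M))) => R < Torus.tnorm (X'.1.1.2 - Y'.1.1.2)), ‖((hubbardGridSub L₂ M β (2 * (2 * M))).transpose * hubbardCovAboveCT L₂ M β μ 0 0 klE0 * hubbardGridSub L₂ M β (2 * (2 * M))) X' Y'‖ ≤ T)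
    {Te : ℝ} (hsec : ∀ (X' : GridLeg (GridPoint L₂ (2 * (2 * M)))) (t : Fin (2 * (2 * M))) (σ c : Fin 2),
      ∑ y ∈ univ.filter (fun y : TorusSite 2 L₂ => R < Torus.tnorm (X'.1.1.2 - y)), ‖((hubbardGridSub L₂ M β (2 * (2 * M))).transpose * hubbardCovAboveCT L₂ M β μ 0 0 klE0 * hubbardGridSub L₂ M β (2 * (2 * M))) X' (((t, y), σ), c)‖ ≤ Te)
    {s s' : ℝ} (hs0 : 0 ≤ s) (hs'0 : 0 ≤ s') (hs : ∀ X Y, ‖((hubbardGridSub L₁ M β (2 * (2 * M))).transpose * hubbardCovAboveCT L₁ M β μ 0 0 klE0 * hubbardGridSub L₁ M β (2 * (2 * M))) X Y‖ ≤ s) (hs' : ∀ X' Y', ‖((hubbardGridSub L₂ M β (2 * (2 * M))).transpose * hubbardCovAboveCT L₂ M β μ 0 0 klE0 * hubbardGridSub L₂ M β (2 * (2 * M))) X' Y'‖ ≤ s')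
    {α α' : ℝ} (hαα : 0 < α' + α) (hrow : ∀ X, ∑ Y, ‖((hubbardGridSub L₁ M β (2 * (2 * M))).transpose * hubbardCovAboveCT L₁ M β μ 0 0 klE0 * hubbardGridSub L₁ M β (2 * (2 * M))) X Y‖ ≤ α) (hrow' : ∀ X', ∑ Y', ‖((hubbardGridSub L₂ M β (2 * (2 * M))).transpose * hubbardCovAboveCT L₂ M β μ 0 0 klE0 * hubbardGridSub L₂ M β (2 * (2 * M))) X' Y'‖ ≤ α')
    {m₁ m₁' : ℝ} (hm0 : 0 ≤ m₁) (hm0' : 0 ≤ m₁')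
    (hm1 : ∀ X, ∑ Y, ‖((hubbardGridSub L₁ M β (2 * (2 * M))).transpose * hubbardCovAboveCT L₁ M β μ 0 0 klE0 * hubbardGridSub L₁ M β (2 * (2 * M))) X Y‖ * (Torus.tnorm (X.1.1.2 - Y.1.1.2) : ℝ) ≤ m₁)
    (hm1' : ∀ X', ∑ Y', ‖((hubbardGridSub L₂ M β (2 * (2 * M))).transpose * hubbardCovAboveCT L₂ M β μ 0 0 klE0 * hubbardGridSub L₂ M β (2 * (2 * M))) X' Y'‖ *
      (Torus.tnorm ((fun i => (((X'.1.1.2 i).val : ℕ) : ZMod L₁)) - fun i => (((Y'.1.1.2 i).val : ℕ) : ZMod L₁)) : ℝ) ≤ m₁')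
    {κ κ' : ℝ} (hκ : 0 < κ) (hκ' : 0 ≤ κ') (hGB : IsGramBoundedR ((hubbardGridSub L₁ M β (2 * (2 * M))).transpose * hubbardCovAboveCT L₁ M β μ 0 0 klE0 * hubbardGridSub L₁ M β (2 * (2 * M))) κ) (hGB' : IsGramBoundedR ((hubbardGridSub L₂ M β (2 * (2 * M))).transpose * hubbardCovAboveCT L₂ M β μ 0 0 klE0 * hubbardGridSub L₂ M β (2 * (2 * M))) κ')
    -- the two grid partition functions
    (hZc : IsUnit (effPartitionFn ℂ ((hubbardGridSub L₁ M β (2 * (2 * M))).transpose * hubbardCovAboveCT L₁ M β μ 0 0 klE0 * hubbardGridSub L₁ M β (2 * (2 * M))) (hubbardGridInteraction L₁ (2 * (2 * M)) β U)))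
    (hZf : IsUnit (effPartitionFn ℂ ((hubbardGridSub L₂ M β (2 * (2 * M))).transpose * hubbardCovAboveCT L₂ M β μ 0 0 klE0 * hubbardGridSub L₂ M β (2 * (2 * M))) (hubbardGridInteraction L₂ (2 * (2 * M)) β U)))
    -- the coarse weighted profile, the fine degree-2 profile, the smallness conditions
    (Nw : ℕ → ℝ) (hNw0 : ∀ m, 0 ≤ Nw m)
    (hNw : ∀ (m' : ℕ) (j : Fin (2 * m')) (x : GridLeg (GridPoint L₁ (2 * (2 * M)))),
      ∑ Y ∈ univ.filter (fun Y : Fin (2 * m') → GridLeg (GridPoint L₁ (2 * (2 * M))) => Y j = x),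
        ‖kernel ℂ (effAction ℂ ((hubbardGridSub L₁ M β (2 * (2 * M))).transpose * hubbardCovAboveCT L₁ M β μ 0 0 klE0 * hubbardGridSub L₁ M β (2 * (2 * M))) (hubbardGridInteraction L₁ (2 * (2 * M)) β U)) (2 * m') Y‖ *
          (1 + labelDiam (fun Y₁ Y₂ : GridLeg (GridPoint L₁ (2 * (2 * M))) => (Torus.tnorm (Y₁.1.1.2 - Y₂.1.1.2) : ℝ)) (univ.image Y)) ≤ Nw m')
    {ρf : ℝ} (hρf : 0 < ρf)
    (hθw : Real.exp 1 * (α' + α + (m₁' + m₁)) * normV (GridLeg (GridPoint L₂ (2 * (2 * M)))) (κ' + κ) ρf Nw / (κ' + κ) ^ 2 < 1)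
    {ρ₂ : ℝ} (hρ₂ : 0 < ρ₂)
    (hθ₂ : Real.exp 1 * (α' + α + (m₁' + m₁)) * normV (GridLeg (GridPoint L₂ (2 * (2 * M)))) (κ' + κ + (κ' + κ + (κ' + κ))) ρ₂ Nw /
      (κ' + κ + (κ' + κ + (κ' + κ))) ^ 2 < 1)
    {Nw₁ : ℝ}
    (hNw1 : ∑ Y ∈ univ.filter (fun Y : Fin 2 → GridLeg (GridPoint L₂ (2 * (2 * M))) => Y 0 = ((((0 : Fin (2 * (2 * M))), fun _ => (((L₁ - 1) / 2 : ℕ) : ZMod L₂)), 0), 0)),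
      ‖kernel ℂ (effAction ℂ ((hubbardGridSub L₂ M β (2 * (2 * M))).transpose * hubbardCovAboveCT L₂ M β μ 0 0 klE0 * hubbardGridSub L₂ M β (2 * (2 * M))) (hubbardGridInteraction L₂ (2 * (2 * M)) β U)) 2 Y‖ * (1 + labelDiam (fun Y₁ Y₂ : GridLeg (GridPoint L₂ (2 * (2 * M))) => (Torus.tnorm (Y₁.1.1.2 - Y₂.1.1.2) : ℝ)) (univ.image Y)) ≤ Nw₁)
    (θ : ℝ) :
    |klLocalPart L₁ M β U μ (klFlowFrameU L₁ M β U μ 0) 0 θ - klLocalPart L₂ M β U μ (klFlowFrameU L₂ M β U μ 0) 0 θ| ≤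
      2 * ((2 * (2 * M) : ℕ) : ℝ) / |β| *
      (((((1 + 1 + 1) * (1 + 1 + 2) : ℕ) : ℝ) / 2 * Te * (ρ₂⁻¹ ^ (1 + 3) * (Real.exp 1 * normV (GridLeg (GridPoint L₂ (2 * (2 * M)))) (κ' + κ + (κ' + κ + (κ' + κ))) ρ₂ Nw) / (1 - Real.exp 1 * (α' + α + (m₁' + m₁)) * normV (GridLeg (GridPoint L₂ (2 * (2 * M)))) (κ' + κ + (κ' + κ + (κ' + κ))) ρ₂ Nw / (κ' + κ + (κ' + κ + (κ' + κ))) ^ 2)) +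
          ‖(2 : ℂ)⁻¹‖ * ∑ a ∈ range (1 + 2), ∑ b' ∈ range (1 + 2),
            (if a + b' = 1 + 1 then (((a + 1) * (b' + 1) : ℕ) : ℝ) *
              (2 * T * (ρ₂⁻¹ ^ (a + 1) * (Real.exp 1 * normV (GridLeg (GridPoint L₂ (2 * (2 * M)))) (κ' + κ + (κ' + κ + (κ' + κ))) ρ₂ Nw) / (1 - Real.exp 1 * (α' + α + (m₁' + m₁)) * normV (GridLeg (GridPoint L₂ (2 * (2 * M)))) (κ' + κ + (κ' + κ + (κ' + κ))) ρ₂ Nw / (κ' + κ + (κ' + κ + (κ' + κ))) ^ 2)) * (ρ₂⁻¹ ^ (b' + 1) * (Real.exp 1 * normV (GridLeg (GridPoint L₂ (2 * (2 * M)))) (κ' + κ + (κ' + κ + (κ' + κ))) ρ₂ Nw) / (1 - Real.exp 1 * (α' + α + (m₁' + m₁)) * normV (GridLeg (GridPoint L₂ (2 * (2 * M)))) (κ' + κ + (κ' + κ + (κ' + κ))) ρ₂ Nw / (κ' + κ + (κ' + κ + (κ' + κ))) ^ 2)) +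
                2 * T * (ρ₂⁻¹ ^ (a + 1) * (Real.exp 1 * normV (GridLeg (GridPoint L₂ (2 * (2 * M)))) (κ' + κ + (κ' + κ + (κ' + κ))) ρ₂ Nw) / (1 - Real.exp 1 * (α' + α + (m₁' + m₁)) * normV (GridLeg (GridPoint L₂ (2 * (2 * M)))) (κ' + κ + (κ' + κ + (κ' + κ))) ρ₂ Nw / (κ' + κ + (κ' + κ + (κ' + κ))) ^ 2)) * (ρ₂⁻¹ ^ (b' + 1) * (Real.exp 1 * normV (GridLeg (GridPoint L₂ (2 * (2 * M)))) (κ' + κ + (κ' + κ + (κ' + κ))) ρ₂ Nw) / (1 - Real.exp 1 * (α' + α + (m₁' + m₁)) * normV (GridLeg (GridPoint L₂ (2 * (2 * M)))) (κ' + κ + (κ' + κ + (κ' + κ))) ρ₂ Nw / (κ' + κ + (κ' + κ + (κ' + κ))) ^ 2))) else 0)) +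
        ((((1 + 1 + 1) * (1 + 1 + 2) : ℕ) : ℝ) / 2 * ((s' + s) / ((R' : ℝ) + 1)) *
            (ρf⁻¹ ^ (1 + 3) * (Real.exp 1 * normV (GridLeg (GridPoint L₂ (2 * (2 * M)))) (κ' + κ) ρf Nw) /
              (1 - Real.exp 1 * (α' + α + (m₁' + m₁)) * normV (GridLeg (GridPoint L₂ (2 * (2 * M)))) (κ' + κ) ρf Nw / (κ' + κ) ^ 2)) +
          ‖(2 : ℂ)⁻¹‖ * ∑ a ∈ range (1 + 2), ∑ b' ∈ range (1 + 2),
            (if a + b' = 1 + 1 then (((a + 1) * (b' + 1) : ℕ) : ℝ) *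
              ((α' + α) *
                  (ρf⁻¹ ^ (a + 1) * (Real.exp 1 * normV (GridLeg (GridPoint L₂ (2 * (2 * M)))) (κ' + κ) ρf Nw) /
                      (1 - Real.exp 1 * (α' + α + (m₁' + m₁)) * normV (GridLeg (GridPoint L₂ (2 * (2 * M)))) (κ' + κ) ρf Nw / (κ' + κ) ^ 2) / ((R' : ℝ) + 1)) *
                  (ρf⁻¹ ^ (b' + 1) * (Real.exp 1 * normV (GridLeg (GridPoint L₂ (2 * (2 * M)))) (κ' + κ) ρf Nw) /
                    (1 - Real.exp 1 * (α' + α + (m₁' + m₁)) * normV (GridLeg (GridPoint L₂ (2 * (2 * M)))) (κ' + κ) ρf Nw / (κ' + κ) ^ 2)) +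
                (α' + α) *
                  (ρf⁻¹ ^ (a + 1) * (Real.exp 1 * normV (GridLeg (GridPoint L₂ (2 * (2 * M)))) (κ' + κ) ρf Nw) /
                    (1 - Real.exp 1 * (α' + α + (m₁' + m₁)) * normV (GridLeg (GridPoint L₂ (2 * (2 * M)))) (κ' + κ) ρf Nw / (κ' + κ) ^ 2)) *
                  (ρf⁻¹ ^ (b' + 1) * (Real.exp 1 * normV (GridLeg (GridPoint L₂ (2 * (2 * M)))) (κ' + κ) ρf Nw) /
                      (1 - Real.exp 1 * (α' + α + (m₁' + m₁)) * normV (GridLeg (GridPoint L₂ (2 * (2 * M)))) (κ' + κ) ρf Nw / (κ' + κ) ^ 2) / ((R' : ℝ) + 1))) else 0))) +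
        2 * (2 * ((2 * (2 * M) : ℕ) : ℝ) / |β| * Nw₁ / (((L₁ - 1) / 2 + 1 : ℕ) : ℝ)) := by
  classical
  letI : LinearOrder (GridLeg (GridPoint L₂ (2 * (2 * M)))) := LinearOrder.lift' (Fintype.equivFin (GridLeg (GridPoint L₂ (2 * (2 * M))))) (Fintype.equivFin _).injective
  have hdvd : L₁ ∣ L₂ := ⟨b, by rw [hL, mul_comm]⟩
  have hL₁₂ : L₁ ≤ L₂ := by
    have hb0 : b ≠ 0 := by rintro rfl; exact NeZero.ne L₂ (by rw [hL, zero_mul])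
    rw [hL]; exact Nat.le_mul_of_pos_left _ (Nat.pos_of_ne_zero hb0)
  have hr : (L₁ - 1) / 2 < L₁ := by have := NeZero.pos L₁; omega
  -- the symbol function of the bare frame
  set F : MatsubaraIdx M → Fin 2 → (Fin 2 → ℝ) → ℂ := fun i _ q =>
    uvSymbolFn 1 klE0 (-2 * (∑ l : Fin 2, Real.cos (q l)) - μ - (0 : TrigPolyC4v).eval q) (matsubaraFreq β M i) with hF
  have hpL : ∀ (L : ℕ) [NeZero L] (k : FreqMomentum L M) (σ : Fin 2),
      uvSymbolCT L M β μ 0 klE0 (k, σ) = ((β * (L : ℝ) ^ 2 : ℝ) : ℂ) * F k.1 σ (latticeMomentum L k.2) := by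
    intro L _ k σ
    obtain ⟨i, kv⟩ := k
    exact uvSymbolCT_eq_mul_sampled hβ μ 0 klE0 i kv σ
  have hcov : ∀ (L : ℕ) [NeZero L], (hubbardGridSub L M β (2 * (2 * M))).transpose * hubbardCovAboveCT L M β μ 0 0 klE0 *
      hubbardGridSub L M β (2 * (2 * M)) = (hubbardGridSub L M β (2 * (2 * M))).transpose *
        normalCovariance L M (uvSymbolCT L M β μ 0 klE0) * hubbardGridSub L M β (2 * (2 * M)) := by
    intro L _; rw [hubbardCovAboveCT_zero_seed_eq_normalCovariance_uvSymbolCT]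
  -- the pin is `(R + R′)`-deep
  have hw : ∀ j : Fin 2, R + R' ≤ ((((((0 : Fin (2 * (2 * M))), fun _ => (((L₁ - 1) / 2 : ℕ) : ZMod L₂)), 0), 0) : GridLeg (GridPoint L₂ (2 * (2 * M)))).1.1.2 j).val % L₁ ∧
      ((((((0 : Fin (2 * (2 * M))), fun _ => (((L₁ - 1) / 2 : ℕ) : ZMod L₂)), 0), 0) : GridLeg (GridPoint L₂ (2 * (2 * M)))).1.1.2 j).val % L₁ + (R + R') < L₁ := by
    intro j
    dsimp only
    rw [ZMod.val_natCast, Nat.mod_eq_of_lt (hr.trans_le hL₁₂), Nat.mod_eq_of_lt hr]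
    omega
  -- the interactions with `ν = 0`
  have hZc' : IsUnit (effPartitionFn ℂ ((hubbardGridSub L₁ M β (2 * (2 * M))).transpose * hubbardCovAboveCT L₁ M β μ 0 0 klE0 * hubbardGridSub L₁ M β (2 * (2 * M)))
      (hubbardGridInteraction L₁ (2 * (2 * M)) β U + (0 : ℂ) • hubbardGridQuadratic L₁ (2 * (2 * M)) β)) := by
    rwa [zero_smul, add_zero]
  have hNw' : ∀ (m' : ℕ) (j : Fin (2 * m')) (x : GridLeg (GridPoint L₁ (2 * (2 * M)))),
      ∑ Y ∈ univ.filter (fun Y : Fin (2 * m') → GridLeg (GridPoint L₁ (2 * (2 * M))) => Y j = x),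
        ‖kernel ℂ (effAction ℂ ((hubbardGridSub L₁ M β (2 * (2 * M))).transpose * hubbardCovAboveCT L₁ M β μ 0 0 klE0 * hubbardGridSub L₁ M β (2 * (2 * M)))
          (hubbardGridInteraction L₁ (2 * (2 * M)) β U + (0 : ℂ) • hubbardGridQuadratic L₁ (2 * (2 * M)) β)) (2 * m') Y‖ *
          (1 + labelDiam (fun Y₁ Y₂ : GridLeg (GridPoint L₁ (2 * (2 * M))) => (Torus.tnorm (Y₁.1.1.2 - Y₂.1.1.2) : ℝ)) (univ.image Y)) ≤ Nw m' := by
    simpa only [zero_smul, add_zero] using hNw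
  -- the model step at `n = 1`, `p = 0`, `ν = 0`
  have hB := hubbardGrid_sum_norm_kernel_sub_le_response (b := b) (L := L₁) (Lf := L₂) (M := M) (N := 2 * (2 * M)) hL hβ.ne' F
    (uvSymbolCT L₁ M β μ 0 klE0) (uvSymbolCT L₂ M β μ 0 klE0) (hpL L₁) (hpL L₂)
    ((hubbardGridSub L₁ M β (2 * (2 * M))).transpose * hubbardCovAboveCT L₁ M β μ 0 0 klE0 * hubbardGridSub L₁ M β (2 * (2 * M))) (hcov L₁) ((hubbardGridSub L₂ M β (2 * (2 * M))).transpose * hubbardCovAboveCT L₂ M β μ 0 0 klE0 * hubbardGridSub L₂ M β (2 * (2 * M))) (hcov L₂) R R' ((((0 : Fin (2 * (2 * M))), fun _ => (((L₁ - 1) / 2 : ℕ) : ZMod L₂)), 0), 0) hw hT0 hT hsec hs0 hs'0 hs hs' hαα hrow hrow' hm0 hm0' hm1 hm1' hκ hκ' hGB hGB'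
    U 0 hZc' Nw hNw0 hNw' hρf hθw hρ₂ hθ₂ 1 0
  simp only [zero_smul, add_zero] at hB
  exact abs_klLocalPart_flowFrame_zero_sub_le hdvd hβ U μ hZc hZf hB hNw1 θ

end Summit.HubbardSuperconductivity.HubbardSuperconductivity.Theorems.TwoVolumeDefect

end
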